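import Mathlib
import Summits.CriticalPhenomena.CardyFormulaZ2.Theorems.CardySelfRefinementGradientComparabilityStubJointCrossingNondegenerate
import HarnessLib

/-!
# Tubes along arbitrary chart paths, and the tube events with their supports

Crux `stmt-CriticalPhenomena-10269`
(`Summit.CriticalPhenomena.CardyFormulaZ2.Theses.CardySelfRefinement.GradientComparability`),
line **Sketch**, helper file of the stub `stub_bulkPivotalSum_diverges` (D3-bulk): the skeletons
of the non-degeneracy-given-the-layer argument are tubes along ROUTED arcs (not only along the
middle leaf of the straightening chart as in (D1) `stub_jointCrossing_tube`), of prescribed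
small width, and the argument needs the SUPPORT of the tube events.

## Mathematics

* `tube_of_chart_path` — for a quad `Q` straightened by `H` (`[Q] = H([-1,1]²)`, `∂₀Q`, `∂₂Q` the
  images of the vertical sides) and ANY path `γ` in chart coordinates inside
  `[-2,2] × [-½,½]` from `re = -2` to `re = 2`, and any `smax > 0`: points `P₀,…,P_N` on the arc
  `H ∘ γ` at consecutive distances `≤ s ≤ smax` such that every continuum `C ⊆ GOOD` within `10s`
  of the points and reaching the `10s`-neighbourhoods of `P₀`, `P_N` contains a crossing of `Q`
  inside `GOOD` (chart room `exists_chart_room`, uniform continuity,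
  `exists_subcontinuum_between_lines`; the proof of (D1) verbatim with `γ` for the leaf).
* `eventually_tube_of_data` — from such tube data: increasing measurable events `T η` of
  probability `≥ c₁ > 0` for all small meshes (RSW `square_boxCrossing_holds` ⨉ Harris–FKG),
  READ OFF the edges whose endpoints are drawn within `6s` of the points `P_j`, on which every
  lattice configuration has, for every shift `|re t|, |im t| ≤ 2η`, a crossing `K` of `Q` with
  `K − t` inside its drawn open edges ((D1) `eventually_tube` plus the support).
-/

noncomputable section

namespace Summit.CriticalPhenomena.CardyFormulaZ2.Theorems.CardySelfRefinement

open scoped Topology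
open Filter Set MeasureTheory Metric
open Literature.Probability.LatticeModels Literature.Probability.Percolation
open Literature.Probability.Percolation.QuadCrossing
open Literature.Topology.PlaneTopology

/-! ## The tube along a chart path -/

/-- **The tube lemma along an arbitrary chart path.** -/
theorem tube_of_chart_path (Q : Quad (Set.univ : Set ℂ)) (H : ℂ ≃ₜ ℂ)
    (hcar : Q.carrier = H '' (Icc (-1 : ℝ) 1 ×ℂ Icc (-1 : ℝ) 1))
    (h0 : Q.side 0 = H '' {z | z ∈ Icc (-1 : ℝ) 1 ×ℂ Icc (-1 : ℝ) 1 ∧ z.re = -1})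
    (h2 : Q.side 2 = H '' {z | z ∈ Icc (-1 : ℝ) 1 ×ℂ Icc (-1 : ℝ) 1 ∧ z.re = 1})
    {γ : ℝ → ℂ} (hγ : ContinuousOn γ (Icc 0 1))
    (hγR : MapsTo γ (Icc 0 1) (Icc (-2 : ℝ) 2 ×ℂ Icc (-1 / 2 : ℝ) (1 / 2)))
    (hγ0 : (γ 0).re = -2) (hγ1 : (γ 1).re = 2) {smax : ℝ} (hsmax : 0 < smax) :
    ∃ (N : ℕ) (P : ℕ → ℂ) (s : ℝ), 0 < s ∧ s ≤ smax ∧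
      (∀ j ≤ N, ∃ u ∈ Icc (0 : ℝ) 1, P j = H (γ u)) ∧
      (∀ j < N, dist (P j) (P (j + 1)) ≤ s) ∧
      ∀ (GOOD C : Set ℂ), IsCompact C → IsPreconnected C → C ⊆ GOOD →
        (∀ z ∈ C, ∃ j ≤ N, dist z (P j) ≤ 10 * s) → (∃ z ∈ C, dist z (P 0) ≤ 10 * s) →
        (∃ z ∈ C, dist z (P N) ≤ 10 * s) → ∃ K, Q.IsCrossing K ∧ K ⊆ GOOD := by
  have hRc : IsCompact (Icc (-2 : ℝ) 2 ×ℂ Icc (-1 / 2 : ℝ) (1 / 2)) :=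
    Metric.isCompact_of_isClosed_isBounded (isClosed_Icc.reProdIm isClosed_Icc)
      ((isBounded_Icc _ _).reProdIm (isBounded_Icc _ _))
  obtain ⟨ρ, hρ, hroom⟩ := Literature.Topology.PlaneTopology.exists_chart_room H hRc
    (by norm_num : (0 : ℝ) < 1 / 2)
  set g : ℝ → ℂ := fun x => H (γ x) with hg
  have hgc : ContinuousOn g (Icc 0 1) := H.continuous.comp_continuousOn hγ
  set s : ℝ := min (ρ / 20) smax with hs
  have hspos : 0 < s := lt_min (by positivity) hsmax
  have hsρ : 20 * s ≤ ρ := by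
    have : s ≤ ρ / 20 := min_le_left _ _
    linarith
  obtain ⟨τ, hτ, hτg⟩ := Metric.uniformContinuousOn_iff_le.1
    (isCompact_Icc.uniformContinuousOn_of_continuous hgc) s hspos
  obtain ⟨N, hN⟩ := exists_nat_gt (1 / τ)
  have hNpos : (0 : ℝ) < N := lt_trans (by positivity) hN
  have hstep : 1 / (N : ℝ) ≤ τ := by
    rw [div_le_iff₀ hNpos]
    have := (div_lt_iff₀ hτ).1 hN
    linarith
  set x : ℕ → ℝ := fun j => j / N with hx
  have hxmem : ∀ j ≤ N, x j ∈ Icc (0 : ℝ) 1 := fun j hj => by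
    have hj' : (j : ℝ) ≤ N := by exact_mod_cast hj
    exact ⟨by positivity, (div_le_one hNpos).2 hj'⟩
  refine ⟨N, fun j => g (x j), s, hspos, min_le_right _ _, fun j hj => ⟨x j, hxmem j hj, rfl⟩,
    fun j hj => ?_, ?_⟩
  · refine hτg (x j) (hxmem j hj.le) (x (j + 1)) (hxmem (j + 1) hj) ?_
    rw [Real.dist_eq]
    simp only [hx, Nat.cast_add, Nat.cast_one]
    rw [show (j : ℝ) / N - ((j : ℝ) + 1) / N = -(1 / N) by ring, abs_neg,
      abs_of_pos (by positivity)]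
    exact hstep
  intro GOOD C hC hCc hCG hnear hP0 hPN
  -- chart positions of the points of `C`
  have hpull : ∀ z : ℂ, ∀ j ≤ N, dist z (g (x j)) ≤ 10 * s →
      |(H.symm z).re - (γ (x j)).re| ≤ 1 / 2 ∧ |(H.symm z).im| ≤ 1 := fun z j hj hd => by
    have h := hroom (γ (x j)) (hγR (hxmem j hj)) z (by simp only [hg] at hd; linarith)
    rw [dist_eq_norm] at h
    have hre := (Complex.abs_re_le_norm (H.symm z - γ (x j))).trans h
    have him := (Complex.abs_im_le_norm (H.symm z - γ (x j))).trans h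
    rw [Complex.sub_re] at hre
    rw [Complex.sub_im] at him
    refine ⟨hre, ?_⟩
    have hγim := (Complex.mem_reProdIm.1 (hγR (hxmem j hj))).2
    rw [mem_Icc] at hγim
    rw [abs_le] at him ⊢
    constructor <;> linarith [hγim.1, hγim.2]
  set C' : Set ℂ := H.symm '' C with hC'
  have hband : ∀ w ∈ C', |w.im| ≤ 1 := by
    rintro _ ⟨z, hz, rfl⟩
    obtain ⟨j, hj, hd⟩ := hnear z hz
    exact (hpull z j hj hd).2
  obtain ⟨z0, hz0, hz0d⟩ := hP0
  obtain ⟨zN, hzN, hzNd⟩ := hPN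
  have hx0 : x 0 = 0 := by simp [hx]
  have hxN : x N = 1 := by
    simp only [hx]
    rw [div_self hNpos.ne']
  have hre0 : (H.symm z0).re ≤ -1 := by
    have := (hpull z0 0 (Nat.zero_le _) hz0d).1
    rw [hx0, hγ0, abs_le] at this
    linarith [this.2]
  have hreN : 1 ≤ (H.symm zN).re := by
    have := (hpull zN N le_rfl hzNd).1
    rw [hxN, hγ1, abs_le] at this
    linarith [this.1]
  obtain ⟨K', hK'C, hK'c, hK'p, hK'strip, ⟨u, hu, hure⟩, ⟨v, hv, hvre⟩⟩ :=
    exists_subcontinuum_between_lines (a := -1) (b := 1) (by norm_num) (hC.image H.symm.continuous)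
      (hCc.image _ H.symm.continuous.continuousOn) ⟨_, ⟨z0, hz0, rfl⟩, hre0⟩
      ⟨_, ⟨zN, hzN, rfl⟩, hreN⟩
  have hK'sq : K' ⊆ Icc (-1 : ℝ) 1 ×ℂ Icc (-1 : ℝ) 1 := fun w hw => by
    have h1 := hK'strip w hw
    have h2 := abs_le.1 (hband w (hK'C hw))
    exact Complex.mem_reProdIm.2 ⟨⟨h1.1, h1.2⟩, ⟨by linarith [h2.1], by linarith [h2.2]⟩⟩
  refine ⟨H '' K', ⟨hK'c.image H.continuous,
    ⟨⟨H u, mem_image_of_mem _ hu⟩, hK'p.image _ H.continuous.continuousOn⟩, ?_, ?_, ?_⟩, ?_⟩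
  · rw [hcar]; exact image_mono hK'sq
  · rw [h0]; exact ⟨H u, mem_image_of_mem _ hu, mem_image_of_mem _ ⟨hK'sq hu, hure⟩⟩
  · rw [h2]; exact ⟨H v, mem_image_of_mem _ hv, mem_image_of_mem _ ⟨hK'sq hv, hvre⟩⟩
  · rintro _ ⟨w, hw, rfl⟩
    obtain ⟨z, hz, rfl⟩ := hK'C hw
    rw [Homeomorph.apply_symm_apply]
    exact hCG hz

/-! ## The tube events and their supports -/

/-- Coordinates of a drawn site at mesh `η`. -/
theorem re_im_eta_mul_z (η : ℝ) (v : Site 2) :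
    ((η : ℂ) * squareLatticeEmbedding.z v).re = η * (Real.sqrt 2 * (v 0 : ℝ)) ∧
      ((η : ℂ) * squareLatticeEmbedding.z v).im = η * (Real.sqrt 2 * (v 1 : ℝ)) := by
  have h1 := squareLatticeEmbedding_z_sub_re v 0
  have h2 := squareLatticeEmbedding_z_sub_im v 0
  rw [sub_zero] at h1 h2
  rw [Complex.zero_re, sub_zero] at h1
  rw [Complex.zero_im, sub_zero] at h2
  constructor
  · rw [Complex.mul_re, Complex.ofReal_re, Complex.ofReal_im, zero_mul, sub_zero, h1]
  · rw [Complex.mul_im, Complex.ofReal_re, Complex.ofReal_im, zero_mul, add_zero, h2]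

/-- An intersection of finitely many events determined by `D` is determined by `D`. -/
theorem determinedBy_biInter_finset {ι α : Type*} {D : Set α} (s : Finset ι) {f : ι → Set (Set α)}
    (h : ∀ i ∈ s, DeterminedBy (f i) D) : DeterminedBy (⋂ i ∈ s, f i) D := by
  classical
  induction s using Finset.induction_on with
  | empty => simpa using determinedBy_univ D
  | insert a s ha ih =>
    rw [Finset.set_biInter_insert]
    exact (h a (Finset.mem_insert_self a s)).inter (ih fun i hi => h i (Finset.mem_insert_of_mem hi))

/-- The support of a rectangle crossing event of the drawing `v ↦ z v - w`: pairs of sites whose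
shifted positions lie in the enlarged rectangle. -/
theorem determinedBy_embRectCrossing (w : ℂ) (a b : ℝ) :
    DeterminedBy (embRectCrossing (fun v => squareLatticeEmbedding.z v - w) a b)
      {e : Sym2 (Site 2) | ∀ x ∈ e, (squareLatticeEmbedding.z x - w).re ∈ Icc (-2) (a + 2) ∧
        (squareLatticeEmbedding.z x - w).im ∈ Icc 0 b} := by
  classical
  set S : Set (Site 2) := {v | (squareLatticeEmbedding.z v - w).re ∈ Icc (-2) (a + 2) ∧
    (squareLatticeEmbedding.z v - w).im ∈ Icc 0 b} with hS
  have hSf : S.Finite := by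
    refine (finite_setOf_dist_meshPoint_le (δ := Real.sqrt 2) (by positivity) w
      (|a| + |b| + 4)).subset fun v hv => ?_
    obtain ⟨⟨h1, h2⟩, ⟨h3, h4⟩⟩ := hv
    rw [squareLatticeEmbedding_z_sub_re] at h1 h2
    rw [squareLatticeEmbedding_z_sub_im] at h3 h4
    show dist (meshPoint (Real.sqrt 2) v) w ≤ |a| + |b| + 4
    rw [dist_eq_norm]
    refine (Complex.norm_le_abs_re_add_abs_im _).trans ?_
    have hre : (meshPoint (Real.sqrt 2) v - w).re = Real.sqrt 2 * (v 0 : ℝ) - w.re := by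
      simp [meshPoint]
    have him : (meshPoint (Real.sqrt 2) v - w).im = Real.sqrt 2 * (v 1 : ℝ) - w.im := by
      simp [meshPoint]
    rw [hre, him]
    cases abs_cases (Real.sqrt 2 * (v 0 : ℝ) - w.re) <;>
      cases abs_cases (Real.sqrt 2 * (v 1 : ℝ) - w.im) <;> cases abs_cases a <;>
        cases abs_cases b <;> linarith
  have h := PlanarDuality.determinedBy_openCrossing hSf.toFinset
    {v : Site 2 | (squareLatticeEmbedding.z v - w).re ≤ 0} {v | a ≤ (squareLatticeEmbedding.z v - w).re}
  rw [hSf.coe_toFinset] at h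
  refine h.mono fun e he => ?_
  rw [Finset.mem_coe, Finset.mem_sym2_iff] at he
  exact fun x hx => hSf.mem_toFinset.1 (he x hx)

/-- The support of a vertical rectangle crossing event of the drawing `v ↦ z v - w`. -/
theorem determinedBy_embTBCrossing (w : ℂ) (a b : ℝ) :
    DeterminedBy (embTBCrossing (fun v => squareLatticeEmbedding.z v - w) a b)
      {e : Sym2 (Site 2) | ∀ x ∈ e, (squareLatticeEmbedding.z x - w).re ∈ Icc 0 a ∧
        (squareLatticeEmbedding.z x - w).im ∈ Icc (-2) (b + 2)} := by
  classical
  set S : Set (Site 2) := {v | (squareLatticeEmbedding.z v - w).re ∈ Icc 0 a ∧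
    (squareLatticeEmbedding.z v - w).im ∈ Icc (-2) (b + 2)} with hS
  have hSf : S.Finite := by
    refine (finite_setOf_dist_meshPoint_le (δ := Real.sqrt 2) (by positivity) w
      (|a| + |b| + 4)).subset fun v hv => ?_
    obtain ⟨⟨h1, h2⟩, ⟨h3, h4⟩⟩ := hv
    rw [squareLatticeEmbedding_z_sub_re] at h1 h2
    rw [squareLatticeEmbedding_z_sub_im] at h3 h4
    show dist (meshPoint (Real.sqrt 2) v) w ≤ |a| + |b| + 4
    rw [dist_eq_norm]
    refine (Complex.norm_le_abs_re_add_abs_im _).trans ?_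
    have hre : (meshPoint (Real.sqrt 2) v - w).re = Real.sqrt 2 * (v 0 : ℝ) - w.re := by
      simp [meshPoint]
    have him : (meshPoint (Real.sqrt 2) v - w).im = Real.sqrt 2 * (v 1 : ℝ) - w.im := by
      simp [meshPoint]
    rw [hre, him]
    cases abs_cases (Real.sqrt 2 * (v 0 : ℝ) - w.re) <;>
      cases abs_cases (Real.sqrt 2 * (v 1 : ℝ) - w.im) <;> cases abs_cases a <;>
        cases abs_cases b <;> linarith
  have h := PlanarDuality.determinedBy_openCrossing hSf.toFinset
    {v : Site 2 | (squareLatticeEmbedding.z v - w).im ≤ 0} {v | b ≤ (squareLatticeEmbedding.z v - w).im}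
  rw [hSf.coe_toFinset] at h
  refine h.mono fun e he => ?_
  rw [Finset.mem_coe, Finset.mem_sym2_iff] at he
  exact fun x hx => hSf.mem_toFinset.1 (he x hx)

/-- Drawn sites of the rectangles of the tube lie within `6s` of the corresponding point. -/
theorem dist_le_six_of_mem_rect {η s : ℝ} (hη : 0 < η) (hηs : 6 * η ≤ s) {n : ℕ}
    (hn' : η * n ≤ s) (P : ℂ) (x : Site 2)
    (h : ((squareLatticeEmbedding.z x -
        ⟨(P.re - 3 * s - 2 * η) / η, (P.im - s + 2 * η) / η⟩).re ∈ Icc (-2 : ℝ) (8 * n + 2) ∧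
      (squareLatticeEmbedding.z x -
        ⟨(P.re - 3 * s - 2 * η) / η, (P.im - s + 2 * η) / η⟩).im ∈ Icc (0 : ℝ) n) ∨
      ((squareLatticeEmbedding.z x -
        ⟨(P.re - s + 2 * η) / η, (P.im - 3 * s - 2 * η) / η⟩).re ∈ Icc (0 : ℝ) n ∧
      (squareLatticeEmbedding.z x -
        ⟨(P.re - s + 2 * η) / η, (P.im - 3 * s - 2 * η) / η⟩).im ∈ Icc (-2 : ℝ) (8 * n + 2))) :
    dist ((η : ℂ) * squareLatticeEmbedding.z x) P ≤ 6 * s := by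
  obtain ⟨hre, him⟩ := re_im_eta_mul_z η x
  rw [dist_eq_norm]
  refine (Complex.norm_le_abs_re_add_abs_im _).trans ?_
  rw [Complex.sub_re, Complex.sub_im, hre, him]
  have hnn : (0 : ℝ) ≤ η * n := by positivity
  rcases h with ⟨⟨h1, h2⟩, ⟨h3, h4⟩⟩ | ⟨⟨h1, h2⟩, ⟨h3, h4⟩⟩
  · rw [squareLatticeEmbedding_z_sub_re] at h1 h2
    rw [squareLatticeEmbedding_z_sub_im] at h3 h4
    simp only at h1 h2 h3 h4
    have e1 : η * (Real.sqrt 2 * (x 0 : ℝ)) - P.re =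
        η * (Real.sqrt 2 * (x 0 : ℝ) - (P.re - 3 * s - 2 * η) / η) - 3 * s - 2 * η := by
      field_simp; ring
    have e2 : η * (Real.sqrt 2 * (x 1 : ℝ)) - P.im =
        η * (Real.sqrt 2 * (x 1 : ℝ) - (P.im - s + 2 * η) / η) - s + 2 * η := by
      field_simp; ring
    rw [e1, e2]
    cases abs_cases (η * (Real.sqrt 2 * (x 0 : ℝ) - (P.re - 3 * s - 2 * η) / η) - 3 * s - 2 * η) <;>
      cases abs_cases (η * (Real.sqrt 2 * (x 1 : ℝ) - (P.im - s + 2 * η) / η) - s + 2 * η) <;>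
        nlinarith [mul_le_mul_of_nonneg_left h1 hη.le, mul_le_mul_of_nonneg_left h2 hη.le,
          mul_le_mul_of_nonneg_left h3 hη.le, mul_le_mul_of_nonneg_left h4 hη.le]
  · rw [squareLatticeEmbedding_z_sub_re] at h1 h2
    rw [squareLatticeEmbedding_z_sub_im] at h3 h4
    simp only at h1 h2 h3 h4
    have e1 : η * (Real.sqrt 2 * (x 0 : ℝ)) - P.re =
        η * (Real.sqrt 2 * (x 0 : ℝ) - (P.re - s + 2 * η) / η) - s + 2 * η := by
      field_simp; ring
    have e2 : η * (Real.sqrt 2 * (x 1 : ℝ)) - P.im =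
        η * (Real.sqrt 2 * (x 1 : ℝ) - (P.im - 3 * s - 2 * η) / η) - 3 * s - 2 * η := by
      field_simp; ring
    rw [e1, e2]
    cases abs_cases (η * (Real.sqrt 2 * (x 0 : ℝ) - (P.re - s + 2 * η) / η) - s + 2 * η) <;>
      cases abs_cases (η * (Real.sqrt 2 * (x 1 : ℝ) - (P.im - 3 * s - 2 * η) / η) - 3 * s - 2 * η) <;>
        nlinarith [mul_le_mul_of_nonneg_left h1 hη.le, mul_le_mul_of_nonneg_left h2 hη.le,
          mul_le_mul_of_nonneg_left h3 hη.le, mul_le_mul_of_nonneg_left h4 hη.le]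

/-- **Crossings of the tube rectangles force a crossing of the quad** ((D1) `exists_tube_events`
for given tube data). -/
theorem exists_tube_events_of_data (Q : Quad (Set.univ : Set ℂ)) {N : ℕ} {P : ℕ → ℂ} {s : ℝ}
    (hP : ∀ j < N, dist (P j) (P (j + 1)) ≤ s)
    (htube : ∀ (GOOD C : Set ℂ), IsCompact C → IsPreconnected C → C ⊆ GOOD →
        (∀ z ∈ C, ∃ j ≤ N, dist z (P j) ≤ 10 * s) → (∃ z ∈ C, dist z (P 0) ≤ 10 * s) →
        (∃ z ∈ C, dist z (P N) ≤ 10 * s) → ∃ K, Q.IsCrossing K ∧ K ⊆ GOOD) :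
    ∀ η : ℝ, 0 < η → 6 * η ≤ s → ∀ n : ℕ, s - η < η * n → η * n ≤ s →
      ∀ t : ℂ, |t.re| ≤ 2 * η → |t.im| ≤ 2 * η →
      ∀ ω : BondConfig (Site 2), ω ⊆ (zdGraph 2).edgeSet →
        (∀ j ≤ N,
          ω ∈ embRectCrossing (fun v => squareLatticeEmbedding.z v -
            ⟨((P j).re - 3 * s - 2 * η) / η, ((P j).im - s + 2 * η) / η⟩) (8 * n) n ∧
          ω ∈ embTBCrossing (fun v => squareLatticeEmbedding.z v -
            ⟨((P j).re - s + 2 * η) / η, ((P j).im - 3 * s - 2 * η) / η⟩) n (8 * n)) →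
        ∃ K, Q.IsCrossing K ∧ ∀ z ∈ K, z - t ∈ openEdgeUnion (η * Real.sqrt 2) ω := by
  intro η hη hηs n hn hn' t htr hti ω hω hbox
  have HH : ∀ j ≤ N, ∃ C : Set ℂ, IsCompact C ∧ IsPreconnected C ∧
      C ⊆ Icc ((P j).re - 4 * s) ((P j).re + 6 * s) ×ℂ Icc ((P j).im - s) ((P j).im + s) ∧
      (∀ z ∈ C, z - t ∈ openEdgeUnion (η * Real.sqrt 2) ω) ∧
      (∃ z ∈ C, z.re ≤ (P j).re - 3 * s) ∧ ∃ z ∈ C, (P j).re + 3 * s ≤ z.re := fun j hj =>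
    boxH_continuum hη hηs hn hn' (P j) t htr hti (by simp only; field_simp)
      (by simp only; field_simp) hω (hbox j hj).1
  have HV : ∀ j ≤ N, ∃ C : Set ℂ, IsCompact C ∧ IsPreconnected C ∧
      C ⊆ Icc ((P j).re - s) ((P j).re + s) ×ℂ Icc ((P j).im - 4 * s) ((P j).im + 6 * s) ∧
      (∀ z ∈ C, z - t ∈ openEdgeUnion (η * Real.sqrt 2) ω) ∧
      (∃ z ∈ C, z.im ≤ (P j).im - 3 * s) ∧ ∃ z ∈ C, (P j).im + 3 * s ≤ z.im := fun j hj =>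
    boxV_continuum hη hηs hn hn' (P j) t htr hti (by simp only; field_simp)
      (by simp only; field_simp) hω (hbox j hj).2
  choose! Hc hHc hHp hHR hHO hHa hHb using HH
  choose! Vc hVc hVp hVR hVO hVa hVb using HV
  set GOOD : Set ℂ := {z | z - t ∈ openEdgeUnion (η * Real.sqrt 2) ω} with hGOOD
  obtain ⟨C, hCc, hCp, hCG, hCd, hC0, hCN⟩ := chain P GOOD Hc Vc N hP
    (fun j hj => ⟨hHc j hj, hHp j hj, fun z hz => hHO j hj z hz, hHR j hj, hHa j hj, hHb j hj⟩)
    (fun j hj => ⟨hVc j hj, hVp j hj, fun z hz => hVO j hj z hz, hVR j hj, hVa j hj, hVb j hj⟩)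
  obtain ⟨z0, hz0, -⟩ := hVa 0 (Nat.zero_le _)
  obtain ⟨zN, hzN, -⟩ := hHa N le_rfl
  obtain ⟨K, hK, hKG⟩ := htube GOOD C hCc hCp hCG hCd
    ⟨z0, hC0 hz0, dist_le_of_mem_boxes (Or.inr (hVR 0 (Nat.zero_le _) hz0))⟩
    ⟨zN, hCN hzN, dist_le_of_mem_boxes (Or.inl (hHR N le_rfl hzN))⟩
  exact ⟨K, hK, fun z hz => hKG hz⟩

/-- **The tube events with their supports** ((D1) `eventually_tube` for given tube data, plus the
set of edges off which the events are read). -/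
theorem eventually_tube_of_data (Q : Quad (Set.univ : Set ℂ)) {N : ℕ} {P : ℕ → ℂ} {s : ℝ}
    (hs : 0 < s) (hP : ∀ j < N, dist (P j) (P (j + 1)) ≤ s)
    (htube : ∀ (GOOD C : Set ℂ), IsCompact C → IsPreconnected C → C ⊆ GOOD →
        (∀ z ∈ C, ∃ j ≤ N, dist z (P j) ≤ 10 * s) → (∃ z ∈ C, dist z (P 0) ≤ 10 * s) →
        (∃ z ∈ C, dist z (P N) ≤ 10 * s) → ∃ K, Q.IsCrossing K ∧ K ⊆ GOOD) :
    ∃ (T : ℝ → Set (BondConfig (Site 2))) (c₁ : ℝ), 0 < c₁ ∧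
      ∀ᶠ η : ℝ in 𝓝[>] (0 : ℝ), MeasurableSet (T η) ∧ IsUpperSet (T η) ∧
        c₁ ≤ (bondPercolation (zdGraph 2) half).real (T η) ∧
        DeterminedBy (T η) {e : Sym2 (Site 2) | ∀ x ∈ e, ∃ j ≤ N,
          dist ((η : ℂ) * squareLatticeEmbedding.z x) (P j) ≤ 6 * s} ∧
        ∀ t : ℂ, |t.re| ≤ 2 * η → |t.im| ≤ 2 * η → ∀ ω ∈ T η, ω ⊆ (zdGraph 2).edgeSet →
          ∃ K, Q.IsCrossing K ∧ ∀ z ∈ K, z - t ∈ openEdgeUnion (η * Real.sqrt 2) ω := by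
  have hev := exists_tube_events_of_data Q hP htube
  obtain ⟨c, hc, n₀, hB⟩ := square_boxCrossing_holds 8 (by norm_num)
  set RH : ℝ → ℕ → Set (BondConfig (Site 2)) := fun η j =>
    embRectCrossing (fun v => squareLatticeEmbedding.z v -
      ⟨((P j).re - 3 * s - 2 * η) / η, ((P j).im - s + 2 * η) / η⟩)
      (8 * ⌊s / η⌋₊) ⌊s / η⌋₊ with hRH
  set RV : ℝ → ℕ → Set (BondConfig (Site 2)) := fun η j =>
    embTBCrossing (fun v => squareLatticeEmbedding.z v -
      ⟨((P j).re - s + 2 * η) / η, ((P j).im - 3 * s - 2 * η) / η⟩)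
      ⌊s / η⌋₊ (8 * ⌊s / η⌋₊) with hRV
  refine ⟨fun η => ⋂ j ∈ Finset.range (N + 1), (RH η j ∩ RV η j), (c * c) ^ (N + 1),
    by positivity, ?_⟩
  rw [eventually_nhdsWithin_iff, Metric.eventually_nhds_iff]
  refine ⟨min (s / 6) (s / (n₀ + 1)), by positivity, fun η hη hη0 => ?_⟩
  have hη0 : 0 < η := hη0
  rw [Real.dist_eq, sub_zero, abs_of_pos hη0, lt_min_iff, lt_div_iff₀ (by norm_num : (0:ℝ) < 6),
    lt_div_iff₀ (by positivity : (0:ℝ) < n₀ + 1)] at hη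
  have hηs : 6 * η ≤ s := by linarith [hη.1]
  have hfl := Nat.lt_floor_add_one (s / η)
  have hfl' := Nat.floor_le (div_nonneg hs.le hη0.le)
  rw [div_lt_iff₀ hη0] at hfl
  rw [le_div_iff₀ hη0] at hfl'
  have hn1 : s - η < η * ⌊s / η⌋₊ := by linarith
  have hn2 : η * ⌊s / η⌋₊ ≤ s := by linarith
  have hn0 : n₀ ≤ ⌊s / η⌋₊ := by
    have h2 : (n₀ : ℝ) < ⌊s / η⌋₊ := by
      by_contra hcon
      push Not at hcon
      have := mul_le_mul_of_nonneg_left hcon hη0.le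
      nlinarith [hη.2]
    exact_mod_cast h2.le
  have hmeas : ∀ j, MeasurableSet (RH η j ∩ RV η j) := fun j =>
    (IsoradialArmExtension.measurableSet_embRectCrossing _ _ _).inter
      (IsoradialArmExtension.measurableSet_embTBCrossing _ _ _)
  have hup : ∀ j, IsUpperSet (RH η j ∩ RV η j) := fun j =>
    (isUpperSet_embRectCrossing _ _ _).inter (isUpperSet_embTBCrossing _ _ _)
  refine ⟨(Finset.range (N + 1)).measurableSet_biInter fun j _ => hmeas j,
    isUpperSet_iInter₂ fun j _ => hup j, ?_, ?_, fun t htr hti ω hω hωE => ?_⟩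
  · calc (c * c) ^ (N + 1) = ∏ j ∈ Finset.range (N + 1), c * c := by simp
      _ ≤ ∏ j ∈ Finset.range (N + 1),
            (bondPercolation (zdGraph 2) half).real (RH η j ∩ RV η j) := by
          refine Finset.prod_le_prod (fun _ _ => by positivity) fun j _ => ?_
          have h1 := (hB _ hn0 ⟨((P j).re - 3 * s - 2 * η) / η, ((P j).im - s + 2 * η) / η⟩).1.1
          have h2 := (hB _ hn0 ⟨((P j).re - s + 2 * η) / η, ((P j).im - 3 * s - 2 * η) / η⟩).2.1
          calc c * c ≤ (bondPercolation (zdGraph 2) half).real (RH η j) *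
                (bondPercolation (zdGraph 2) half).real (RV η j) :=
                mul_le_mul h1 h2 hc.le measureReal_nonneg
            _ ≤ _ := harris_fkg_holds (zdGraph 2) half (isUpperSet_embRectCrossing _ _ _)
                (isUpperSet_embTBCrossing _ _ _)
                (IsoradialArmExtension.measurableSet_embRectCrossing _ _ _)
                (IsoradialArmExtension.measurableSet_embTBCrossing _ _ _)
      _ ≤ _ := real_biInter_ge_prod (zdGraph 2) half _ _ (fun j _ => hup j) (fun j _ => hmeas j)
  · refine determinedBy_biInter_finset _ fun j hj => ?_
    have hjN : j ≤ N := Nat.lt_succ_iff.1 (Finset.mem_range.1 hj)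
    refine ((determinedBy_embRectCrossing _ _ _).mono fun e he => ?_).inter
      ((determinedBy_embTBCrossing _ _ _).mono fun e he => ?_)
    · intro x hx
      exact ⟨j, hjN, dist_le_six_of_mem_rect hη0 hηs hn2 (P j) x (Or.inl (he x hx))⟩
    · intro x hx
      exact ⟨j, hjN, dist_le_six_of_mem_rect hη0 hηs hn2 (P j) x (Or.inr (he x hx))⟩
  · refine hev η hη0 hηs _ hn1 hn2 t htr hti ω hωE fun j hj => ?_
    exact mem_iInter₂.1 hω j (Finset.mem_range.2 (Nat.lt_succ_of_le hj))

end Summit.CriticalPhenomena.CardyFormulaZ2.Theorems.CardySelfRefinement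

end
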